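import Summits.NavierStokesRegularity.NavierStokesRegularity.Theses.FilamentSkeletonRss

/-!
# Line `near_straight_newton` — crux `SkeletonJ1` (stmt-NavierStokesRegularity-27413) and its cone successor
# `SkeletonJ1G` (stmt-NavierStokesRegularity-27849), route `FilamentSkeletonRss`

Crux-strategist s1 (planner-cstrat-stmt-NavierStokesRegularity-27413-s1-0), 2026-08-28.  An ALTERNATIVE skeleton to the
registered birth skeleton `FlatSkeleton + NormalBlock` (tenure g8/g11, sha 12616aef…; never overwritten by this seat).

THE REGIME (the line's lever).  `Rb` — the radius constant of the exactness ball `‖y‖ ≤ Rb√(Γ log Γ)` — is existentially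
quantified in the crux, so it may be taken SMALL, at the price `Γ₂ ≥ exp(C/Rb²)`.  In that regime the local-induction
stiffness `(Γγ/8π)·log Γ` beats the frame drift over the whole ball with a Γ-UNIFORM bending budget `O(Rb²)`: every exactly
tangent skeleton is a regular perturbation of a STRAIGHT skew configuration, and the straight configuration is a Γ-FREE,
finite-dimensional datum (closed-form line Biot–Savart + frame).  The crux then splits into four genuine pieces:

* `stub_straightDatum`   — a Γ-free straight skew datum with a unique supercritical zero of the scaled slip (S–M; the `R_π`
                           pair of `Theorems.SelectionBoxRJRung.straightSkew_rung` is the intended witness);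
* `stub_tangentSkeleton` — Newton/shooting from the straight datum to an EXACTLY tangent core-matched skeleton with the
                           transported core areas and the Γ-flat cone bound, near-straight to tolerance `Rb`, for every
                           small `Rb` and all `Γ ≥ Γ₂(Rb)` (XL; rungs `modelArc_rung`, `truePartnerArc_exists`,
                           `nearStraight_liaReduction`, `defect_constants` are its first iterates);
* `stub_clause13`        — clause 13-J (linearised normal non-degeneracy) for near-straight tangent skeletons, by bending
                           dominance `1/Rb²` at the ball scale and the dispersion slope of the matched Rosenhead symbol at its
                           turning band `kμ ≈ 1.1` (M–L; model version `model_clause13_injective`);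
* `stub_normalBlock`     — clause 12 from the flat clauses (M; matched-kernel port of `clause12_of_skeleton`).

`SkeletonJ1G_of_hyps` composes the four stub STATEMENTS into the crux matrix (pure logic, sorry-free) and
`SkeletonJ1G_of : SkeletonJ1G` / `SkeletonJ1_of : SkeletonJ1` conclude the route decls BY NAME from the stubs — each the
ONLY theorem of the file concluding its decl (`skeletonJ1G_iff` / `skeletonJ1_iff := Iff.rfl` certify that `J1GMatrix` /
`J1Matrix` are the crux matrices verbatim).  HONEST FRAMING: a plan for a HYPOTHETICAL filament skeleton on the NEGATIVE
side of a MODEL route; nothing in this file bears on Navier–Stokes regularity or blow-up.  Sorries: exactly the four stubs.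
-/

set_option linter.dupNamespace false
set_option linter.unusedVariables false

noncomputable section

namespace Summit.NavierStokesRegularity.NavierStokesRegularity.Cruxes.SkeletonJ1.NearStraightNewton

open scoped BigOperators Topology InnerProductSpace
open Filter Set Function MeasureTheory
open Literature.Analysis.FluidPDE
open Summit.NavierStokesRegularity.NavierStokesRegularity.Theses.FilamentSkeletonRss

/-- The matrix of `SkeletonJ1G` — everything after `∀ Γ ≥ Γ₂, ∃ data` — VERBATIM (clauses 0–13J, area law, cone
bound, normal block).  `η` is not a parameter: it occurs in no clause of the crux. -/
def J1GMatrix (N : ℕ) (δ ρ K Λ a b cnd Rw Rb cg θ₀ KA Γ : ℝ) (γ : Fin N → ℝ) (α : ℝ) (X : Fin N → ℝ → EuclideanSpace ℝ (Fin 3))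
    (w : Fin N → ℝ → ℝ) (c : Fin N → ℝ) (m n : Fin N → EuclideanSpace ℝ (Fin 3)) (Aa : Fin N → ℝ → ℝ) : Prop :=
  ∀ (u:(Fin N → ℝ → EuclideanSpace ℝ (Fin 3)) → EuclideanSpace ℝ (Fin 3) → EuclideanSpace ℝ (Fin 3)) (v:EuclideanSpace ℝ (Fin 3) → EuclideanSpace ℝ (Fin 3)) (A:Fin N → (EuclideanSpace ℝ (Fin 3) →L[ℝ] EuclideanSpace ℝ (Fin 3))) (T:(Fin N → ℝ → EuclideanSpace ℝ (Fin 3)) → Fin N → ℝ → EuclideanSpace ℝ (Fin 3)), (∀ Z y, u Z y = ∑ k, (Γ*γ k/(4*Real.pi))•∫ σ:ℝ, ((‖y-Z k σ‖^2+Real.exp (-(1+Real.eulerMascheroniConstant-Real.log 2))*Aa k σ)^(3/2:ℝ))⁻¹•cross (deriv (Z k) σ) (y-Z k σ))→(∀ y, v y = u X y+(1/2:ℝ)•y-α•cross (EuclideanSpace.single 2 1) y)→(∀ j, A j = fderiv ℝ v (X j (c j)))→(∀ Z j τ, T Z j τ = (u Z (Z j τ)+(1/2:ℝ)•Z j τ-α•cross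 (EuclideanSpace.single 2 1) (Z j τ))-(⟪u Z (Z j τ)+(1/2:ℝ)•Z j τ-α•cross (EuclideanSpace.single 2 1) (Z j τ), deriv (Z j) τ⟫_ℝ/‖deriv (Z j) τ‖^2)•deriv (Z j) τ)→(α ≠ 0 ∧ (∀ j, γ j ≠ 0) ∧ (∀ j, ContDiff ℝ 2 (X j) ∧ Differentiable ℝ (w j)∧(∀ τ, ‖deriv (X j) τ‖ = 1)∧(∀ τ, ‖iteratedDeriv 2 (X j) τ‖*√Γ≤K) ∧ Tendsto (fun τ => ‖X j τ‖) (cocompact ℝ) atTop) ∧ (∀ j k, j ≠ k → ∀ τ σ, ρ*√Γ≤‖X j τ-X k σ‖) ∧ (∀ j τ σ, ρ*√Γ≤|τ-σ| → cg*ρ*√Γ≤‖X j τ-X j σ‖) ∧ (∀ j τ, cg*|τ-c j|≤Rw*√Γ+‖X j τ‖) ∧ (∀ j τ, w j τ = ⟪v (X j τ), deriv (X j) τ⟫_ℝ) ∧ (∀ j τ, ‖X j τ‖≤Rb*√(Γ*Real.log Γ) → v (X j τ) = w j τ•deriv (X j) τ) ∧ (∀ j, ‖X j (c j)‖≤Rw*√Γ)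 ∧ (∀ j, |⟪deriv (X j) (c j), EuclideanSpace.single 2 1⟫_ℝ|≤1-θ₀) ∧ (θ₀≤|α| ∧ |α|≤θ₀⁻¹ ∧ ∀ j, θ₀≤|γ j| ∧ |γ j|≤θ₀⁻¹) ∧ (∀ j, w j (c j) = 0 ∧ (∀ τ, w j τ = 0 → τ = c j) ∧ 3/2+δ≤deriv (w j) (c j) ∧ deriv (w j) (c j)≤Λ) ∧ (∀ j, Differentiable ℝ (Aa j) ∧ (∀ τ, 0 < Aa j τ) ∧ ∀ τ, w j τ*deriv (Aa j) τ = (3/2-deriv (w j) τ)*Aa j τ+4) ∧ (∀ j τ, Rw^2*Γ*Aa j τ≤KA*(Rw^2*Γ+‖X j τ‖^2)) ∧ (∀ j, Orthonormal ℝ ![deriv (X j) (c j), m j, n j] ∧ ⟪A j (m j), m j⟫_ℝ+⟪A j (n j), n j⟫_ℝ < 0 ∧ ⟪A j (n j), m j⟫_ℝ * ⟪A j (m j), n j⟫_ℝ < ⟪A j (m j), m j⟫_ℝ * ⟪A j (n j), n j⟫_ℝ) ∧ (∀ Y:Fin N → ℝ → EuclideanSpace ℝ (Fin 3), (∀ j,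 ContDiff ℝ 2 (Y j))→(∀ j τ, ⟪Y j τ, deriv (X j) τ⟫_ℝ = 0) → (∀ j τ, Rb*√(Γ*Real.log Γ) < ‖X j τ‖ → Y j τ = 0) → ∑ j, ⟪Y j (c j), cross (EuclideanSpace.single 2 1) (X j (c j))⟫_ℝ = 0 → (∀ j τ, ‖Y j τ‖+‖deriv (Y j) τ‖+‖iteratedDeriv 2 (Y j) τ‖≤(1+|τ-c j|)^b) → ∀ L:ℝ, (∀ j τ, ‖deriv (fun s:ℝ => T (fun k σ => X k σ+s•Y k σ) j τ) 0‖≤L*(1+|τ-c j|)^a) → ∀ j τ, ‖Y j τ‖≤cnd*L*(1+|τ-c j|)^b))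

/-- The matrix of the A1α crux `SkeletonJ1` (stmt-27413; an aside of the route since rev 23): `J1GMatrix` minus the
cone-bound clause, VERBATIM. -/
def J1Matrix (N : ℕ) (δ ρ K Λ a b cnd Rw Rb cg θ₀ Γ : ℝ) (γ : Fin N → ℝ) (α : ℝ) (X : Fin N → ℝ → EuclideanSpace ℝ (Fin 3))
    (w : Fin N → ℝ → ℝ) (c : Fin N → ℝ) (m n : Fin N → EuclideanSpace ℝ (Fin 3)) (Aa : Fin N → ℝ → ℝ) : Prop :=
  ∀ (u:(Fin N → ℝ → EuclideanSpace ℝ (Fin 3)) → EuclideanSpace ℝ (Fin 3) → EuclideanSpace ℝ (Fin 3)) (v:EuclideanSpace ℝ (Fin 3) → EuclideanSpace ℝ (Fin 3)) (A:Fin N → (EuclideanSpace ℝ (Fin 3) →L[ℝ] EuclideanSpace ℝ (Fin 3))) (T:(Fin N → ℝ → EuclideanSpace ℝ (Fin 3)) → Fin N → ℝ → EuclideanSpace ℝ (Fin 3)), (∀ Z y, u Z y = ∑ k, (Γ*γ k/(4*Real.pi))•∫ σ:ℝ, ((‖y-Z k σ‖^2+Real.exp (-(1+Real.eulerMascheroniConstant-Real.log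 2))*Aa k σ)^(3/2:ℝ))⁻¹•cross (deriv (Z k) σ) (y-Z k σ))→(∀ y, v y = u X y+(1/2:ℝ)•y-α•cross (EuclideanSpace.single 2 1) y)→(∀ j, A j = fderiv ℝ v (X j (c j)))→(∀ Z j τ, T Z j τ = (u Z (Z j τ)+(1/2:ℝ)•Z j τ-α•cross (EuclideanSpace.single 2 1) (Z j τ))-(⟪u Z (Z j τ)+(1/2:ℝ)•Z j τ-α•cross (EuclideanSpace.single 2 1) (Z j τ), deriv (Z j) τ⟫_ℝ/‖deriv (Z j) τ‖^2)•deriv (Z j) τ)→(α ≠ 0 ∧ (∀ j, γ j ≠ 0) ∧ (∀ j, ContDiff ℝ 2 (X j) ∧ Differentiable ℝ (w j)∧(∀ τ, ‖deriv (X j) τ‖ = 1)∧(∀ τ, ‖iteratedDeriv 2 (X j) τ‖*√Γ≤K) ∧ Tendsto (fun τ => ‖X j τ‖) (cocompact ℝ) atTop) ∧ (∀ j k, j ≠ k → ∀ τ σ, ρ*√Γ≤‖X j τ-X k σ‖) ∧ (∀ j τ σ, ρ*√Γ≤|τ-σ| → cg*ρ*√Γ≤‖X j τ-X j σ‖) ∧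 (∀ j τ, cg*|τ-c j|≤Rw*√Γ+‖X j τ‖) ∧ (∀ j τ, w j τ = ⟪v (X j τ), deriv (X j) τ⟫_ℝ) ∧ (∀ j τ, ‖X j τ‖≤Rb*√(Γ*Real.log Γ) → v (X j τ) = w j τ•deriv (X j) τ) ∧ (∀ j, ‖X j (c j)‖≤Rw*√Γ) ∧ (∀ j, |⟪deriv (X j) (c j), EuclideanSpace.single 2 1⟫_ℝ|≤1-θ₀) ∧ (θ₀≤|α| ∧ |α|≤θ₀⁻¹ ∧ ∀ j, θ₀≤|γ j| ∧ |γ j|≤θ₀⁻¹) ∧ (∀ j, w j (c j) = 0 ∧ (∀ τ, w j τ = 0 → τ = c j) ∧ 3/2+δ≤deriv (w j) (c j) ∧ deriv (w j) (c j)≤Λ) ∧ (∀ j, Differentiable ℝ (Aa j) ∧ (∀ τ, 0 < Aa j τ) ∧ ∀ τ, w j τ*deriv (Aa j) τ = (3/2-deriv (w j) τ)*Aa j τ+4) ∧ (∀ j, Orthonormal ℝ ![deriv (X j) (c j), m j, n j] ∧ ⟪A j (m j), m j⟫_ℝ+⟪A j (n j), n j⟫_ℝ < 0 ∧ ⟪A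 j (n j), m j⟫_ℝ * ⟪A j (m j), n j⟫_ℝ < ⟪A j (m j), m j⟫_ℝ * ⟪A j (n j), n j⟫_ℝ) ∧ (∀ Y:Fin N → ℝ → EuclideanSpace ℝ (Fin 3), (∀ j, ContDiff ℝ 2 (Y j))→(∀ j τ, ⟪Y j τ, deriv (X j) τ⟫_ℝ = 0) → (∀ j τ, Rb*√(Γ*Real.log Γ) < ‖X j τ‖ → Y j τ = 0) → ∑ j, ⟪Y j (c j), cross (EuclideanSpace.single 2 1) (X j (c j))⟫_ℝ = 0 → (∀ j τ, ‖Y j τ‖+‖deriv (Y j) τ‖+‖iteratedDeriv 2 (Y j) τ‖≤(1+|τ-c j|)^b) → ∀ L:ℝ, (∀ j τ, ‖deriv (fun s:ℝ => T (fun k σ => X k σ+s•Y k σ) j τ) 0‖≤L*(1+|τ-c j|)^a) → ∀ j τ, ‖Y j τ‖≤cnd*L*(1+|τ-c j|)^b))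

/-- FLAT PART of the matrix: clauses 0–11, the area law and the Γ-flat cone bound (everything except the normal block,
clause 12, and the linearised non-degeneracy, clause 13-J), verbatim. -/
def FlatJ1G (N : ℕ) (δ ρ K Λ Rw Rb cg θ₀ KA Γ : ℝ) (γ : Fin N → ℝ) (α : ℝ) (X : Fin N → ℝ → EuclideanSpace ℝ (Fin 3)) (w : Fin N → ℝ → ℝ) (c : Fin N → ℝ) (Aa : Fin N → ℝ → ℝ) : Prop :=
  ∀ (u:(Fin N → ℝ → EuclideanSpace ℝ (Fin 3)) → EuclideanSpace ℝ (Fin 3) → EuclideanSpace ℝ (Fin 3)) (v:EuclideanSpace ℝ (Fin 3) → EuclideanSpace ℝ (Fin 3)) (A:Fin N → (EuclideanSpace ℝ (Fin 3) →L[ℝ] EuclideanSpace ℝ (Fin 3))) (T:(Fin N → ℝ → EuclideanSpace ℝ (Fin 3)) → Fin N → ℝ → EuclideanSpace ℝ (Fin 3)), (∀ Z y, u Z y = ∑ k, (Γ*γ k/(4*Real.pi))•∫ σ:ℝ, ((‖y-Z k σ‖^2+Real.exp (-(1+Real.eulerMascheroniConstant-Real.log 2))*Aa k σ)^(3/2:ℝ))⁻¹•cross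 (deriv (Z k) σ) (y-Z k σ))→(∀ y, v y = u X y+(1/2:ℝ)•y-α•cross (EuclideanSpace.single 2 1) y)→(∀ j, A j = fderiv ℝ v (X j (c j)))→(∀ Z j τ, T Z j τ = (u Z (Z j τ)+(1/2:ℝ)•Z j τ-α•cross (EuclideanSpace.single 2 1) (Z j τ))-(⟪u Z (Z j τ)+(1/2:ℝ)•Z j τ-α•cross (EuclideanSpace.single 2 1) (Z j τ), deriv (Z j) τ⟫_ℝ/‖deriv (Z j) τ‖^2)•deriv (Z j) τ)→(α ≠ 0 ∧ (∀ j, γ j ≠ 0) ∧ (∀ j, ContDiff ℝ 2 (X j) ∧ Differentiable ℝ (w j)∧(∀ τ, ‖deriv (X j) τ‖ = 1)∧(∀ τ, ‖iteratedDeriv 2 (X j) τ‖*√Γ≤K) ∧ Tendsto (fun τ => ‖X j τ‖) (cocompact ℝ) atTop) ∧ (∀ j k, j ≠ k → ∀ τ σ, ρ*√Γ≤‖X j τ-X k σ‖) ∧ (∀ j τ σ, ρ*√Γ≤|τ-σ| → cg*ρ*√Γ≤‖X j τ-X j σ‖) ∧ (∀ j τ, cg*|τ-c j|≤Rw*√Γ+‖X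 j τ‖) ∧ (∀ j τ, w j τ = ⟪v (X j τ), deriv (X j) τ⟫_ℝ) ∧ (∀ j τ, ‖X j τ‖≤Rb*√(Γ*Real.log Γ) → v (X j τ) = w j τ•deriv (X j) τ) ∧ (∀ j, ‖X j (c j)‖≤Rw*√Γ) ∧ (∀ j, |⟪deriv (X j) (c j), EuclideanSpace.single 2 1⟫_ℝ|≤1-θ₀) ∧ (θ₀≤|α| ∧ |α|≤θ₀⁻¹ ∧ ∀ j, θ₀≤|γ j| ∧ |γ j|≤θ₀⁻¹) ∧ (∀ j, w j (c j) = 0 ∧ (∀ τ, w j τ = 0 → τ = c j) ∧ 3/2+δ≤deriv (w j) (c j) ∧ deriv (w j) (c j)≤Λ) ∧ (∀ j, Differentiable ℝ (Aa j) ∧ (∀ τ, 0 < Aa j τ) ∧ ∀ τ, w j τ*deriv (Aa j) τ = (3/2-deriv (w j) τ)*Aa j τ+4) ∧ (∀ j τ, Rw^2*Γ*Aa j τ≤KA*(Rw^2*Γ+‖X j τ‖^2)))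

/-- CLAUSE 12 (normal block at the stagnation points) for SOME normal frames `m n`, verbatim. -/
def Clause12J1G (N : ℕ) (Γ : ℝ) (γ : Fin N → ℝ) (α : ℝ) (X : Fin N → ℝ → EuclideanSpace ℝ (Fin 3)) (w : Fin N → ℝ → ℝ) (c : Fin N → ℝ) (Aa : Fin N → ℝ → ℝ) : Prop :=
  ∃ (m n : Fin N → EuclideanSpace ℝ (Fin 3)), ∀ (u:(Fin N → ℝ → EuclideanSpace ℝ (Fin 3)) → EuclideanSpace ℝ (Fin 3) → EuclideanSpace ℝ (Fin 3)) (v:EuclideanSpace ℝ (Fin 3) → EuclideanSpace ℝ (Fin 3)) (A:Fin N → (EuclideanSpace ℝ (Fin 3) →L[ℝ] EuclideanSpace ℝ (Fin 3))) (T:(Fin N → ℝ → EuclideanSpace ℝ (Fin 3)) → Fin N → ℝ → EuclideanSpace ℝ (Fin 3)), (∀ Z y, u Z y = ∑ k, (Γ*γ k/(4*Real.pi))•∫ σ:ℝ, ((‖y-Z k σ‖^2+Real.exp (-(1+Real.eulerMascheroniConstant-Real.log 2))*Aa k σ)^(3/2:ℝ))⁻¹•cross (deriv (Z k) σ) (y-Z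 k σ))→(∀ y, v y = u X y+(1/2:ℝ)•y-α•cross (EuclideanSpace.single 2 1) y)→(∀ j, A j = fderiv ℝ v (X j (c j)))→(∀ Z j τ, T Z j τ = (u Z (Z j τ)+(1/2:ℝ)•Z j τ-α•cross (EuclideanSpace.single 2 1) (Z j τ))-(⟪u Z (Z j τ)+(1/2:ℝ)•Z j τ-α•cross (EuclideanSpace.single 2 1) (Z j τ), deriv (Z j) τ⟫_ℝ/‖deriv (Z j) τ‖^2)•deriv (Z j) τ)→(∀ j, Orthonormal ℝ ![deriv (X j) (c j), m j, n j] ∧ ⟪A j (m j), m j⟫_ℝ+⟪A j (n j), n j⟫_ℝ < 0 ∧ ⟪A j (n j), m j⟫_ℝ * ⟪A j (m j), n j⟫_ℝ < ⟪A j (m j), m j⟫_ℝ * ⟪A j (n j), n j⟫_ℝ)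

/-- CLAUSE 13-J (weighted injectivity of the linearised normal-velocity map on ball-supported normal variations modulo the
`e₃`-rotation), verbatim. -/
def Clause13J1G (N : ℕ) (a b cnd Rb Γ : ℝ) (γ : Fin N → ℝ) (α : ℝ) (X : Fin N → ℝ → EuclideanSpace ℝ (Fin 3)) (w : Fin N → ℝ → ℝ) (c : Fin N → ℝ) (Aa : Fin N → ℝ → ℝ) : Prop :=
  ∀ (u:(Fin N → ℝ → EuclideanSpace ℝ (Fin 3)) → EuclideanSpace ℝ (Fin 3) → EuclideanSpace ℝ (Fin 3)) (v:EuclideanSpace ℝ (Fin 3) → EuclideanSpace ℝ (Fin 3)) (A:Fin N → (EuclideanSpace ℝ (Fin 3) →L[ℝ] EuclideanSpace ℝ (Fin 3))) (T:(Fin N → ℝ → EuclideanSpace ℝ (Fin 3)) → Fin N → ℝ → EuclideanSpace ℝ (Fin 3)), (∀ Z y, u Z y = ∑ k, (Γ*γ k/(4*Real.pi))•∫ σ:ℝ, ((‖y-Z k σ‖^2+Real.exp (-(1+Real.eulerMascheroniConstant-Real.log 2))*Aa k σ)^(3/2:ℝ))⁻¹•cross (deriv (Z k) σ) (y-Z k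 σ))→(∀ y, v y = u X y+(1/2:ℝ)•y-α•cross (EuclideanSpace.single 2 1) y)→(∀ j, A j = fderiv ℝ v (X j (c j)))→(∀ Z j τ, T Z j τ = (u Z (Z j τ)+(1/2:ℝ)•Z j τ-α•cross (EuclideanSpace.single 2 1) (Z j τ))-(⟪u Z (Z j τ)+(1/2:ℝ)•Z j τ-α•cross (EuclideanSpace.single 2 1) (Z j τ), deriv (Z j) τ⟫_ℝ/‖deriv (Z j) τ‖^2)•deriv (Z j) τ)→(∀ Y:Fin N → ℝ → EuclideanSpace ℝ (Fin 3), (∀ j, ContDiff ℝ 2 (Y j))→(∀ j τ, ⟪Y j τ, deriv (X j) τ⟫_ℝ = 0) → (∀ j τ, Rb*√(Γ*Real.log Γ) < ‖X j τ‖ → Y j τ = 0) → ∑ j, ⟪Y j (c j), cross (EuclideanSpace.single 2 1) (X j (c j))⟫_ℝ = 0 → (∀ j τ, ‖Y j τ‖+‖deriv (Y j) τ‖+‖iteratedDeriv 2 (Y j) τ‖≤(1+|τ-c j|)^b) → ∀ L:ℝ, (∀ j τ, ‖deriv (fun s:ℝ => T (fun k σ => X k σ+s•Y k σ) j τ) 0‖≤L*(1+|τ-c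 j|)^a) → ∀ j τ, ‖Y j τ‖≤cnd*L*(1+|τ-c j|)^b)

/-- THE REGIME exported by the existence stub and consumed by the clause-13 stub: near-straightness to tolerance `Rb`
(tangent oscillation ≤ `Rb` along every filament), a global slope bound for the slip and a floor for the core areas. -/
def NearStraightJ1G (N : ℕ) (Λ Rb : ℝ) (X : Fin N → ℝ → EuclideanSpace ℝ (Fin 3)) (w : Fin N → ℝ → ℝ) (Aa : Fin N → ℝ → ℝ) : Prop :=
  (∀ j τ σ, ‖deriv (X j) τ - deriv (X j) σ‖ ≤ Rb) ∧ (∀ j τ, |deriv (w j) τ| ≤ Λ) ∧ (∀ j τ, Λ⁻¹ ≤ Aa j τ)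

/-- A STRAIGHT SKEW DATUM (Γ-free, finite-dimensional): `N` unit directions `t j` and offsets `p j` (waist units `y/√Γ`),
circulation parameters `γ j`, frame rate `α`, such that the lines `p j + s•t j` are `ρ`-separated, tilted, parameter-bounded,
and the SCALED SLIP `W j` — tangential component along line `j` of the closed-form line Biot–Savart field of the other lines
plus the frame drift `½y − α e₃ × y` (the self term of a straight line vanishes identically, for any core) — has a zero
`s₀ j` inside the working ball which is non-degenerate and unique QUANTITATIVELY: `mw·|s − s₀ j| ≤ |W j s|`, supercritical
slope `3/2 + δ ≤ W′(s₀ j)`, and `|W′| ≤ Λ`.  (Unscaled: `w(τ) = √Γ·W(τ/√Γ) + O(Γ^(-1/2))` for the regularised kernel.) -/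
def StraightDatum (N : ℕ) (δ ρ Λ Rw θ₀ mw : ℝ) (p t : Fin N → EuclideanSpace ℝ (Fin 3)) (γ : Fin N → ℝ) (α : ℝ)
    (s₀ : Fin N → ℝ) : Prop :=
  (∀ j, ‖t j‖ = 1) ∧
  (∀ j k, j ≠ k → ∀ τ σ : ℝ, ρ ≤ ‖(p j + τ • t j) - (p k + σ • t k)‖) ∧
  (∀ j, |⟪t j, EuclideanSpace.single 2 1⟫_ℝ| ≤ 1 - θ₀) ∧
  (θ₀ ≤ |α| ∧ |α| ≤ θ₀⁻¹ ∧ ∀ j, θ₀ ≤ |γ j| ∧ |γ j| ≤ θ₀⁻¹) ∧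
  (∀ j, ‖p j + s₀ j • t j‖ ≤ Rw) ∧
  (∀ W : Fin N → ℝ → ℝ,
    (∀ j s, W j s = ⟪(∑ k ∈ Finset.univ.erase j, (γ k / (2 * Real.pi)) •
        ((‖(p j + s • t j - p k) - ⟪p j + s • t j - p k, t k⟫_ℝ • t k‖ ^ 2)⁻¹ •
          cross (t k) ((p j + s • t j - p k) - ⟪p j + s • t j - p k, t k⟫_ℝ • t k))) +
        (1 / 2 : ℝ) • (p j + s • t j) - α • cross (EuclideanSpace.single 2 1) (p j + s • t j), t j⟫_ℝ) →
    ∀ j, W j (s₀ j) = 0 ∧ (∀ s, mw * |s - s₀ j| ≤ |W j s|) ∧ 3 / 2 + δ ≤ deriv (W j) (s₀ j) ∧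
      (∀ s, |deriv (W j) s| ≤ Λ))

/-! ## The four stub statements -/

/-- STUB 1 statement: a straight skew datum exists. -/
def StraightDatumExists : Prop :=
  ∃ (N : ℕ) (δ ρ Λ Rw θ₀ mw : ℝ) (p t : Fin N → EuclideanSpace ℝ (Fin 3)) (γ : Fin N → ℝ) (α : ℝ) (s₀ : Fin N → ℝ),
    0 < N ∧ 0 < δ ∧ 0 < ρ ∧ 0 < Rw ∧ 0 < θ₀ ∧ 0 < mw ∧ StraightDatum N δ ρ Λ Rw θ₀ mw p t γ α s₀

/-- STUB 2 statement (the XL step): from a straight datum to EXACTLY tangent core-matched skeletons — flat clauses with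
relaxed constants, `2Kρ ≤ 1`, near-straight to tolerance `Rb` — for every small `Rb` and all large `Γ`. -/
def TangentSkeletonFromStraight : Prop :=
  ∀ (N : ℕ) (δ ρ Λ Rw θ₀ mw : ℝ) (p t : Fin N → EuclideanSpace ℝ (Fin 3)) (γ : Fin N → ℝ) (α : ℝ) (s₀ : Fin N → ℝ),
    0 < N → 0 < δ → 0 < ρ → 0 < Rw → 0 < θ₀ → 0 < mw → StraightDatum N δ ρ Λ Rw θ₀ mw p t γ α s₀ →
    ∃ (δ' ρ' K Λ' Rw' cg θ₀' KA Rb₁ : ℝ), 0 < δ' ∧ 0 < ρ' ∧ 0 < Rw' ∧ 0 < cg ∧ 0 < θ₀' ∧ 0 < Rb₁ ∧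
      2 * K * ρ' ≤ 1 ∧ ∀ Rb : ℝ, 0 < Rb → Rb ≤ Rb₁ → ∃ Γ₂ : ℝ, ∀ Γ : ℝ, Γ₂ ≤ Γ →
        ∃ (X : Fin N → ℝ → EuclideanSpace ℝ (Fin 3)) (w : Fin N → ℝ → ℝ) (c : Fin N → ℝ) (Aa : Fin N → ℝ → ℝ),
          FlatJ1G N δ' ρ' K Λ' Rw' Rb cg θ₀' KA Γ γ α X w c Aa ∧ NearStraightJ1G N Λ' Rb X w Aa

/-- STUB 3 statement: clause 13-J for near-straight exactly tangent skeletons, `Rb ≤ Rb₀(consts)`, `Γ ≥ Γ₀(consts, Rb)`. -/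
def Clause13NearStraight : Prop :=
  ∀ (N : ℕ) (δ ρ K Λ Rw cg θ₀ KA : ℝ), 0 < N → 0 < δ → 0 < ρ → 0 < Rw → 0 < cg → 0 < θ₀ →
    ∃ Rb₀ : ℝ, 0 < Rb₀ ∧ ∀ Rb : ℝ, 0 < Rb → Rb ≤ Rb₀ → ∃ (a b cnd Γ₀ : ℝ), 0 ≤ a ∧ 0 < cnd ∧
      ∀ Γ : ℝ, Γ₀ ≤ Γ → ∀ (γ : Fin N → ℝ) (α : ℝ) (X : Fin N → ℝ → EuclideanSpace ℝ (Fin 3)) (w : Fin N → ℝ → ℝ) (c : Fin N → ℝ) (Aa : Fin N → ℝ → ℝ),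
        FlatJ1G N δ ρ K Λ Rw Rb cg θ₀ KA Γ γ α X w c Aa → NearStraightJ1G N Λ Rb X w Aa →
          Clause13J1G N a b cnd Rb Γ γ α X w c Aa

/-- STUB 4 statement: the normal block (clause 12) from the flat clauses, matched kernel, `2Kρ ≤ 1`, `Γ ≥ Γ₀(consts)`. -/
def NormalBlockMatched : Prop :=
  ∀ (N : ℕ) (δ ρ K Λ Rw Rb cg θ₀ KA : ℝ), 0 < N → 0 < δ → 0 < ρ → 0 < Rw → 0 < Rb → 0 < cg → 0 < θ₀ →
    2 * K * ρ ≤ 1 → ∃ Γ₀ : ℝ, ∀ Γ : ℝ, Γ₀ ≤ Γ → ∀ (γ : Fin N → ℝ) (α : ℝ) (X : Fin N → ℝ → EuclideanSpace ℝ (Fin 3)) (w : Fin N → ℝ → ℝ) (c : Fin N → ℝ) (Aa : Fin N → ℝ → ℝ),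
      FlatJ1G N δ ρ K Λ Rw Rb cg θ₀ KA Γ γ α X w c Aa → Clause12J1G N Γ γ α X w c Aa

/-! ## The stubs (the ONLY sorries of this file) -/

/-- STUB 1 · `stub_straightDatum` · S–M · the `R_π` pair of `straightSkew_rung` (`N = 2`, `γ = 4`, `α = 21/5`, waist
separation `2/5`, tilt 45°; scaled slip `W(s) = (4/(5π))/(4/25 + s²) + s/2 − 21/(25√2)`, unique zero in `(−0.41, −0.39)`,
slope `≈ 2.49`) gives everything but the two quantitative lines `mw·|s − s₀| ≤ |W s|`, `|W′| ≤ Λ`, which follow from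
`F_neg/F_pos/F_strictMonoOn/Fderiv_window` (`…RungStraightSkewTools`) and `W ∼ s/2` at `±∞`. [folklore] -/
theorem stub_straightDatum : StraightDatumExists := by
  sorry

/-- STUB 2 · `stub_tangentSkeleton` · XL · THE hard stub.  Newton / shooting from the straight datum: first iterate = the
cut-off local-induction arc (`modelArc_rung`), true partner coupling by Picard (`truePartnerArc_exists`), self-induction =
local induction + O(Γκ) remainder without `log Γ` (`nearStraight_liaReduction`, `nearStraight_selfInductionTail`,
`defect_constants`), joint fixed point with the transported core areas `w·A′ = (3/2 − w′)A + 4` (regular solution,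
`A(c) = 4/(w′(c) − 3/2)`, `A ∼ C s²` on the frame-relaxed straight arms ⇒ cone bound), zero/slope/waist/tilt persist from the
datum's quantitative margins; small parameter `1/log Γ ≤ Rb²`.  Why it might fail: the matched own-core coefficient
`log(ℓ/μ(τ))` couples `X` and `Aa` at relative order `1/log Γ` only, but the shooting map's Lipschitz constant in `C²` is
`O(1)` — a genuine IFT (bending-dominated linearisation), not a contraction, is needed. -/
theorem stub_tangentSkeleton : TangentSkeletonFromStraight := by
  sorry

/-- STUB 3 · `stub_clause13` · M–L · injectivity with bound `cnd` of the linearised normal-velocity map on ball-supported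
`C²` normal fields: at the ball scale the local-induction term `(Γγ log Γ/8π)·X′ × Y″` dominates frame + partner strain by
`1/Rb²` (Poincaré on the supported segment — `supported_bounds`, `model_clause13_injective`); at core scales the matched
Rosenhead symbol is `O(Γ)` except in a turning band at `kμ ≈ 1.1` (sign change of the static-helix symbol, checked
numerically by this seat), where ball support and the dispersion SLOPE give `≥ Γ/(μ·Rb√(Γ log Γ)) ≫ 1`.  Why it might
fail: the estimate must be `L^∞`-based across the turning band with slowly varying `μ(τ)`, curvature `O(Rb/√(Γ log Γ))`. -/
theorem stub_clause13 : Clause13NearStraight := by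
  sorry

/-- STUB 4 · `stub_normalBlock` · M · port of `SelectionBoxRJRung.clause12_of_skeleton` (p599125; `+1` kernel) to the
matched kernel `exp(−(1+γ_E−log 2))·Aa`: trace `= 3/2 − w′(c) < 0` by `div u = 0` and `v(X(c)) = 0`, determinant by the
own-core swirl; frames from `exists_orthonormal_frame`.  Why it might fail: differentiating the own-tube term under the
integral at the centreline needs `Aa > 0` differentiable (given) and a local modulus for `Aa` (from the area law). -/
theorem stub_normalBlock : NormalBlockMatched := by
  sorry

/-! ## Certification and composition (sorry-free) -/

/-- `J1GMatrix` is the matrix of the route decl `SkeletonJ1G` verbatim (definitional `Iff.rfl`). -/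
theorem skeletonJ1G_iff :
    SkeletonJ1G ↔ ∃ (N : ℕ) (δ ρ K Λ a b cnd η Rw Rb cg θ₀ KA Γ₂ : ℝ), 0 < N ∧ 0 < δ ∧ 0 < ρ ∧ 0 ≤ a ∧ 0 < cnd ∧
      0 < η ∧ 0 < Rw ∧ 0 < Rb ∧ 0 < cg ∧ 0 < θ₀ ∧ ∀ Γ : ℝ, Γ₂ ≤ Γ →
        ∃ (γ : Fin N → ℝ) (α : ℝ) (X : Fin N → ℝ → EuclideanSpace ℝ (Fin 3)) (w : Fin N → ℝ → ℝ) (c : Fin N → ℝ)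
          (m n : Fin N → EuclideanSpace ℝ (Fin 3)) (Aa : Fin N → ℝ → ℝ), J1GMatrix N δ ρ K Λ a b cnd Rw Rb cg θ₀ KA Γ γ α X w c m n Aa :=
  Iff.rfl

/-- `J1Matrix` is the matrix of the route decl `SkeletonJ1` verbatim (definitional `Iff.rfl`). -/
theorem skeletonJ1_iff :
    SkeletonJ1 ↔ ∃ (N : ℕ) (δ ρ K Λ a b cnd η Rw Rb cg θ₀ Γ₂ : ℝ), 0 < N ∧ 0 < δ ∧ 0 < ρ ∧ 0 ≤ a ∧ 0 < cnd ∧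
      0 < η ∧ 0 < Rw ∧ 0 < Rb ∧ 0 < cg ∧ 0 < θ₀ ∧ ∀ Γ : ℝ, Γ₂ ≤ Γ →
        ∃ (γ : Fin N → ℝ) (α : ℝ) (X : Fin N → ℝ → EuclideanSpace ℝ (Fin 3)) (w : Fin N → ℝ → ℝ) (c : Fin N → ℝ)
          (m n : Fin N → EuclideanSpace ℝ (Fin 3)) (Aa : Fin N → ℝ → ℝ), J1Matrix N δ ρ K Λ a b cnd Rw Rb cg θ₀ Γ γ α X w c m n Aa :=
  Iff.rfl

/-- COMPOSITION, closed form (real proof, no `sorry`, no stub constant used): the four stub STATEMENTS imply the cone crux,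
stated through its matrix (`SkeletonJ1G_of` restates it BY NAME).  Pure logic: constants are threaded (`Rb := min Rb₀ Rb₁`,
`η := 1`, `Γ₂ := max …`), then the flat clauses, clause 12 and clause 13-J are re-assembled in the crux's order. -/
theorem SkeletonJ1G_of_hyps (h1 : StraightDatumExists) (h2 : TangentSkeletonFromStraight) (h3 : Clause13NearStraight)
    (h4 : NormalBlockMatched) :
    ∃ (N : ℕ) (δ ρ K Λ a b cnd η Rw Rb cg θ₀ KA Γ₂ : ℝ), 0 < N ∧ 0 < δ ∧ 0 < ρ ∧ 0 ≤ a ∧ 0 < cnd ∧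
      0 < η ∧ 0 < Rw ∧ 0 < Rb ∧ 0 < cg ∧ 0 < θ₀ ∧ ∀ Γ : ℝ, Γ₂ ≤ Γ →
        ∃ (γ : Fin N → ℝ) (α : ℝ) (X : Fin N → ℝ → EuclideanSpace ℝ (Fin 3)) (w : Fin N → ℝ → ℝ) (c : Fin N → ℝ)
          (m n : Fin N → EuclideanSpace ℝ (Fin 3)) (Aa : Fin N → ℝ → ℝ), J1GMatrix N δ ρ K Λ a b cnd Rw Rb cg θ₀ KA Γ γ α X w c m n Aa := by
  obtain ⟨N, δ, ρ, Λ, Rw, θ₀, mw, p, t, γ, α, s₀, hN, hδ, hρ, hRw, hθ₀, hmw, hSD⟩ := h1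
  obtain ⟨δ', ρ', K, Λ', Rw', cg, θ₀', KA, Rb₁, hδ', hρ', hRw', hcg, hθ₀', hRb₁, hKρ, hfam⟩ :=
    h2 N δ ρ Λ Rw θ₀ mw p t γ α s₀ hN hδ hρ hRw hθ₀ hmw hSD
  obtain ⟨Rb₀, hRb₀, h13⟩ := h3 N δ' ρ' K Λ' Rw' cg θ₀' KA hN hδ' hρ' hRw' hcg hθ₀'
  have hRb : 0 < min Rb₀ Rb₁ := lt_min hRb₀ hRb₁
  obtain ⟨a, b, cnd, Γ₀, ha, hcnd, h13'⟩ := h13 (min Rb₀ Rb₁) hRb (min_le_left _ _)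
  obtain ⟨Γ₂, hfam'⟩ := hfam (min Rb₀ Rb₁) hRb (min_le_right _ _)
  obtain ⟨Γ₁, h12⟩ := h4 N δ' ρ' K Λ' Rw' (min Rb₀ Rb₁) cg θ₀' KA hN hδ' hρ' hRw' hRb hcg hθ₀' hKρ
  refine ⟨N, δ', ρ', K, Λ', a, b, cnd, 1, Rw', min Rb₀ Rb₁, cg, θ₀', KA, max Γ₂ (max Γ₀ Γ₁), hN, hδ', hρ', ha, hcnd,
    one_pos, hRw', hRb, hcg, hθ₀', ?_⟩
  intro Γ hΓ
  have hΓ₂ : Γ₂ ≤ Γ := le_trans (le_max_left _ _) hΓ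
  have hΓ₀ : Γ₀ ≤ Γ := le_trans (le_trans (le_max_left _ _) (le_max_right _ _)) hΓ
  have hΓ₁ : Γ₁ ≤ Γ := le_trans (le_trans (le_max_right _ _) (le_max_right _ _)) hΓ
  obtain ⟨X, w, c, Aa, hflat, hns⟩ := hfam' Γ hΓ₂
  have hc13 := h13' Γ hΓ₀ γ α X w c Aa hflat hns
  obtain ⟨m, n, hc12⟩ := h12 Γ hΓ₁ γ α X w c Aa hflat
  refine ⟨γ, α, X, w, c, m, n, Aa, ?_⟩
  intro u v A T hu hv hA hT
  obtain ⟨k0, k1, k2, k3, k4, k5, k6, k7, k8, k9, k10, k11, k12, k13⟩ := hflat u v A T hu hv hA hT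
  exact ⟨k0, k1, k2, k3, k4, k5, k6, k7, k8, k9, k10, k11, k12, k13, hc12 u v A T hu hv hA hT, hc13 u v A T hu hv hA hT⟩

/-- THE SKELETON THEOREM for the cone crux (A12 shape; the only theorem of this file concluding `SkeletonJ1G` by name):
`SkeletonJ1G` from the four registered stubs, used by name; all glue is in the closed `SkeletonJ1G_of_hyps`.  (Closed modulo
the four stub `sorry`s only.) -/
theorem SkeletonJ1G_of : SkeletonJ1G :=
  skeletonJ1G_iff.mpr (SkeletonJ1G_of_hyps stub_straightDatum stub_tangentSkeleton stub_clause13 stub_normalBlock)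

/-- The settled edge "cone crux ⇒ A1α crux" through the matrices (drop the cone-bound clause); sorry-free. -/
theorem skeletonJ1_matrix_of_skeletonJ1G_matrix
    (h : ∃ (N : ℕ) (δ ρ K Λ a b cnd η Rw Rb cg θ₀ KA Γ₂ : ℝ), 0 < N ∧ 0 < δ ∧ 0 < ρ ∧ 0 ≤ a ∧ 0 < cnd ∧
      0 < η ∧ 0 < Rw ∧ 0 < Rb ∧ 0 < cg ∧ 0 < θ₀ ∧ ∀ Γ : ℝ, Γ₂ ≤ Γ →
        ∃ (γ : Fin N → ℝ) (α : ℝ) (X : Fin N → ℝ → EuclideanSpace ℝ (Fin 3)) (w : Fin N → ℝ → ℝ) (c : Fin N → ℝ)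
          (m n : Fin N → EuclideanSpace ℝ (Fin 3)) (Aa : Fin N → ℝ → ℝ), J1GMatrix N δ ρ K Λ a b cnd Rw Rb cg θ₀ KA Γ γ α X w c m n Aa) :
    ∃ (N : ℕ) (δ ρ K Λ a b cnd η Rw Rb cg θ₀ Γ₂ : ℝ), 0 < N ∧ 0 < δ ∧ 0 < ρ ∧ 0 ≤ a ∧ 0 < cnd ∧
      0 < η ∧ 0 < Rw ∧ 0 < Rb ∧ 0 < cg ∧ 0 < θ₀ ∧ ∀ Γ : ℝ, Γ₂ ≤ Γ →
        ∃ (γ : Fin N → ℝ) (α : ℝ) (X : Fin N → ℝ → EuclideanSpace ℝ (Fin 3)) (w : Fin N → ℝ → ℝ) (c : Fin N → ℝ)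
          (m n : Fin N → EuclideanSpace ℝ (Fin 3)) (Aa : Fin N → ℝ → ℝ), J1Matrix N δ ρ K Λ a b cnd Rw Rb cg θ₀ Γ γ α X w c m n Aa := by
  obtain ⟨N, δ, ρ, K, Λ, a, b, cnd, η, Rw, Rb, cg, θ₀, KA, Γ₂, hN, hδ, hρ, ha, hcnd, hη, hRw, hRb, hcg, hθ₀, hbox⟩ := h
  refine ⟨N, δ, ρ, K, Λ, a, b, cnd, η, Rw, Rb, cg, θ₀, Γ₂, hN, hδ, hρ, ha, hcnd, hη, hRw, hRb, hcg, hθ₀, ?_⟩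
  intro Γ hΓ
  obtain ⟨γ, α, X, w, c, m, n, Aa, hmat⟩ := hbox Γ hΓ
  refine ⟨γ, α, X, w, c, m, n, Aa, ?_⟩
  intro u v A T hu hv hA hT
  obtain ⟨k0, k1, k2, k3, k4, k5, k6, k7, k8, k9, k10, k11, k12, k13, k14, k15⟩ := hmat u v A T hu hv hA hT
  exact ⟨k0, k1, k2, k3, k4, k5, k6, k7, k8, k9, k10, k11, k12, k14, k15⟩

/-- `SkeletonJ1G → SkeletonJ1` (an `example`, so that each crux decl has exactly one concluding theorem in this file). -/
example : SkeletonJ1G → SkeletonJ1 :=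
  fun h => skeletonJ1_iff.mpr (skeletonJ1_matrix_of_skeletonJ1G_matrix (skeletonJ1G_iff.mp h))

/-- THE SKELETON THEOREM for the seat's own crux (the only theorem of this file concluding `SkeletonJ1` by name):
`SkeletonJ1` (stmt-27413) from the same four registered stubs. -/
theorem SkeletonJ1_of : SkeletonJ1 :=
  skeletonJ1_iff.mpr (skeletonJ1_matrix_of_skeletonJ1G_matrix
    (SkeletonJ1G_of_hyps stub_straightDatum stub_tangentSkeleton stub_clause13 stub_normalBlock))

end Summit.NavierStokesRegularity.NavierStokesRegularity.Cruxes.SkeletonJ1.NearStraightNewton
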